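import Literature.NumberTheory.GaloisRepresentations.LubinTateRelNormCoherentUnitsPrincipalPart
import Literature.NumberTheory.GaloisRepresentations.LubinTateColemanCoordMomentsTwo
import HarnessLib

/-!
# The logarithmic derivative, the coordinate and the moments of a norm-coherent unit DO NOT SEE its Teichmüller part:
# `δ⟨β⟩ = δβ`, `r_{⟨β⟩} = r_β`, `mom_k(r_{⟨β⟩}) = mom_k(r_β)` (`q = 2`, unramified base `E`)

De Shalit, *Iwasawa theory of elliptic curves with complex multiplication* (1987), Ch. I §2.1 ("the torsion of `𝒰` is `μ_{q−1}`"), §3.4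
Lemma (i) (`δ` is a homomorphism into a torsion-free group), §3.5 (11) (the moments `D^k log g_β (0)` are the Coates–Wiles values); Ch. II §4.9
(the Coates–Wiles homomorphisms of the elliptic units).  In the tree the (c)-capstones are stated for the closure of the PRINCIPAL projections
`⟨e(𝔞)⟩` of the elliptic-unit families (`ellipticUnitsPrincipal₂ = (ellipticUnitsLocal₂ …).principalPart`, `LubinTateRelNormCoherentUnitsPrincipalPart`),
and the (L)-input of `Summit…TowerDataOffsetMoment` (cf2c-w7 g18) is ONE non-zero moment `mom_k(r_{⟨e(𝔞₁)⟩, m})`; the measure lane computes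
the Coates–Wiles values of `e(𝔞₁)` itself.  THIS file identifies the two (everything PROVED, 0 sorry, no definitions, no named facts; powers are the tree's `RelNormCoherentUnits.npow`):

* §1 the Teichmüller family `β·⟨β⟩⁻¹` (powers `β^N` are the tree's `RelNormCoherentUnits.npow`, `relLogDerivSeries_npow`): `val_mul_principalPart_inv` (its components ARE the Teichmüller representatives `ω(β_m)`), `principalPart_mul_mul_principalPart_inv`
  (`⟨β⟩·(β⟨β⟩⁻¹) = β`), `exists_isUnit_and_val_mul_principalPart_inv_pow_eq_one` (`ω(β_m)^{n_m} = 1`, `n_m` a unit), `not_ringChar_dvd_of_isUnit_natCast`,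
  `norm_natCast_eq_one_of_not_dvd` (`p ∤ n ⟹ ‖n‖_E = 1`);
* §2 ★★ `relLogDerivSeries_mul_principalPart_inv_eq_zero` — **`δ(β·⟨β⟩⁻¹) = 0`** WITHOUT comparing residue fields along the tower: with
  `N_M = ∏_{i ≤ M} n_i` (prime to `p`) the powers `(β⟨β⟩⁻¹)^{N_M} → 1` coordinatewise (coordinate `m` IS `1` once `M ≥ m`), so by the CONTINUITY of
  `δ` (`continuous_relLogDerivSeries`) `N_M·δ(β⟨β⟩⁻¹) → 0`; but `‖N_M‖ = 1`, so every coefficient of `δ(β⟨β⟩⁻¹)` is `0`;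
  ★★★ **`relLogDerivSeries_principalPart`** (`δ⟨β⟩ = δβ`), ★★ `relTildeSeries_principalPart`, ★★ `relUnitCoordTwo_principalPart` (`r_{⟨β⟩} = r_β`),
  ★★ `coordMoment_relUnitCoordTwo_principalPart` (`mom_k(r_{⟨β⟩}) = mom_k(r_β)`).

Consequence for the (c)-capstone `…TowerDataOffsetMoment`: its hypothesis `hmom` on `⟨e(𝔞₁)⟩` is literally the same statement on `e(𝔞₁)`.

## References
* E. de Shalit, *Iwasawa theory of elliptic curves with complex multiplication* (1987), Ch. I §2.1, §3.4 Lemma (i), §3.5 (11); Ch. II §4.9. [deShalit1987]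
* J.-P. Serre, *Local Fields* (1979), Ch. II §4 Prop. 8 (Teichmüller representatives). [SerreLocalFields1979]
-/

noncomputable section

open Filter
open scoped PowerSeries.WithPiTopology Topology

namespace Literature.NumberTheory.GaloisRepresentations

section LogDerivPrincipalPart

open GaloisRepresentations.IsNonarchimedeanLocalField LubinTate ValuativeRel Field Finset
open Literature.RingTheory.CompleteLocalRings

variable {F : Type} [Field F] [ValuativeRel F] [TopologicalSpace F] [IsNonarchimedeanLocalField F]

attribute [local instance] ltNormUniformSpace ltNormIsUniformAddGroup rk1 nF nE fintypeResidueField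

variable {π : 𝒪[F]} (hπ : (valuation F).IsUniformizer (π : F))
variable (E : IntermediateField F (AlgebraicClosure F)) [FiniteDimensional F E] [Normal F E] [IsGalois F E]
variable (hq : residueFieldCard F = 2) (hE : E ≤ maxUnramified F) {σ₀ : absoluteGaloisGroup F} (hσ₀ : IsAbsArithFrob σ₀)

/-! ### §1. The Teichmüller family `β·⟨β⟩⁻¹` -/

variable [CharZero F]

omit [Normal F E] in
/-- ★ **The components of `β·⟨β⟩⁻¹` are the Teichmüller representatives `ω(β_m)`** (`β_m = ω(β_m)·⟨β_m⟩`). [cite: SerreLocalFields1979, Ch. II §4 Prop. 8] -/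
theorem RelNormCoherentUnits.val_mul_principalPart_inv (β : RelNormCoherentUnits hπ E) (m : ℕ) :
    (β.mul (β.principalPart.inv hπ E)).val m = teichmullerRep (β.val m) := by
  haveI : FiniteDimensional F (E ⊔ ltField π m : IntermediateField F (AlgebraicClosure F)) :=
    IntermediateField.finiteDimensional_sup E (ltField π m)
  apply Subtype.ext
  have hp0 : ((β.principalPart.val m : unitBall (E ⊔ ltField π m : IntermediateField F (AlgebraicClosure F))) :
      (E ⊔ ltField π m : IntermediateField F (AlgebraicClosure F))) ≠ 0 := β.principalPart.coe_val_ne_zero hπ E m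
  rw [RelNormCoherentUnits.val_mul, Subring.coe_mul, RelNormCoherentUnits.coe_val_inv]
  -- `ω(β_m)·⟨β_m⟩ = β_m`
  have key := congrArg (fun x : unitBall (E ⊔ ltField π m : IntermediateField F (AlgebraicClosure F)) =>
    ((x : unitBall (E ⊔ ltField π m : IntermediateField F (AlgebraicClosure F))) : (E ⊔ ltField π m : IntermediateField F (AlgebraicClosure F))))
    (teichmullerRep_mul_principalPart (β.val m))
  simp only [Subring.coe_mul] at key
  rw [RelNormCoherentUnits.val_principalPart] at hp0 ⊢
  rw [← key, mul_assoc, mul_inv_cancel₀ hp0, mul_one]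

omit [Normal F E] in
/-- **`⟨β⟩·(β⟨β⟩⁻¹) = β`.** [cite: SerreLocalFields1979, Ch. II §4 Prop. 8] -/
theorem RelNormCoherentUnits.principalPart_mul_mul_principalPart_inv (β : RelNormCoherentUnits hπ E) :
    β.principalPart.mul (β.mul (β.principalPart.inv hπ E)) = β := by
  refine RelNormCoherentUnits.ext fun m => Subtype.ext ?_
  have hp0 : ((β.principalPart.val m : unitBall (E ⊔ ltField π m : IntermediateField F (AlgebraicClosure F))) :
      (E ⊔ ltField π m : IntermediateField F (AlgebraicClosure F))) ≠ 0 := β.principalPart.coe_val_ne_zero hπ E m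
  rw [RelNormCoherentUnits.val_mul, RelNormCoherentUnits.val_mul, Subring.coe_mul, Subring.coe_mul, RelNormCoherentUnits.coe_val_inv,
    mul_left_comm, mul_inv_cancel₀ hp0, mul_one]

omit [Normal F E] in
/-- **`ω(β_m)^{n_m} = 1` for some `n_m` invertible in `𝒪_{E K_π^{m+1}}`** (a root of unity of order prime to `p`).
[cite: SerreLocalFields1979, Ch. II §4 Prop. 8] -/
theorem RelNormCoherentUnits.exists_isUnit_and_val_mul_principalPart_inv_pow_eq_one (β : RelNormCoherentUnits hπ E) (m : ℕ) :
    ∃ n : ℕ, IsUnit ((n : ℕ) : unitBall (E ⊔ ltField π m : IntermediateField F (AlgebraicClosure F))) ∧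
      (β.mul (β.principalPart.inv hπ E)).val m ^ n = 1 := by
  obtain ⟨n, hn, h⟩ := exists_isUnit_natCast_and_teichmullerRep_pow_eq_one (β.val m)
  exact ⟨n, hn, by rw [RelNormCoherentUnits.val_mul_principalPart_inv]; exact h⟩

omit [CharZero F] [Normal F E] [IsGalois F E] in
include hπ in
/-- **A natural number that is a unit of `𝒪_{E'}` is prime to the residue characteristic `p`** (`p ∈ π𝒪_{E'}` is not a unit).
[cite: SerreLocalFields1979, Ch. II §4] -/
theorem not_ringChar_dvd_of_isUnit_natCast (E' : IntermediateField F (AlgebraicClosure F)) [FiniteDimensional F E'] {n : ℕ}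
    (hn : IsUnit ((n : ℕ) : unitBall E')) : ¬ ringChar 𝓀[F] ∣ n := by
  rintro ⟨k, rfl⟩
  have hp : ((ringChar 𝓀[F] : ℕ) : unitBall E') ∈ Ideal.span {algebraMap 𝒪[F] (unitBall E') π} := natCast_ringChar_mem_span_pi hπ E'
  have hmem : ((ringChar 𝓀[F] * k : ℕ) : unitBall E') ∈ Ideal.span {algebraMap 𝒪[F] (unitBall E') π} := by
    rw [Nat.cast_mul]; exact Ideal.mul_mem_right _ _ hp
  have htop : Ideal.span {algebraMap 𝒪[F] (unitBall E') π} = ⊤ := Ideal.eq_top_of_isUnit_mem _ hmem hn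
  have hπu : IsUnit (algebraMap 𝒪[F] (unitBall E') π) := (Ideal.span_singleton_eq_top).mp htop
  have hlt : ‖((algebraMap 𝒪[F] (unitBall E') π : unitBall E') : E')‖ < 1 := algebraMap_mem_maxNilIdeal_of_dvd hπ (dvd_refl π)
  exact hlt.ne ((unitBall_isUnit_iff_norm_eq_one E' _).mp hπu)

omit [CharZero F] [Normal F E] [IsGalois F E] in
include hπ in
/-- **`‖n‖_E = 1` for `n` prime to `p`** (`n` is a unit of the Henselian ring `𝒪_E`). [cite: SerreLocalFields1979, Ch. II §4] -/
theorem norm_natCast_eq_one_of_not_dvd {n : ℕ} (hn : ¬ ringChar 𝓀[F] ∣ n) : ‖((n : unitBall E) : E)‖ = 1 := by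
  haveI := henselianRing_unitBall_span_pi hπ E
  have hp : (ringChar 𝓀[F]).Prime := CharP.char_is_prime 𝓀[F] (ringChar 𝓀[F])
  have hu : IsUnit ((n : ℕ) : unitBall E) :=
    Literature.RingTheory.CompleteLocalRings.isUnit_natCast_of_coprime (Ideal.span {algebraMap 𝒪[F] (unitBall E) π}) hp (natCast_ringChar_mem_span_pi hπ E)
      ((Nat.Prime.coprime_iff_not_dvd hp).mpr hn)
  exact (unitBall_isUnit_iff_norm_eq_one E _).mp hu

/-! ### §2. `δ(β·⟨β⟩⁻¹) = 0`, hence `δ⟨β⟩ = δβ`, `r_{⟨β⟩} = r_β`, `mom_k(r_{⟨β⟩}) = mom_k(r_β)` -/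

include hπ in
omit [CharZero F] [Normal F E] [IsGalois F E] in
/-- If `n • D = … → 0` along exponents `n` prime to `p`, then `D = 0`: **`‖n·c‖ = ‖c‖` for `p ∤ n`**, coefficientwise.
[cite: SerreLocalFields1979, Ch. II §1] -/
theorem eq_zero_of_tendsto_nsmul {N : ℕ → ℕ} (hN : ∀ M, ¬ ringChar 𝓀[F] ∣ N M) {D : PowerSeries (unitBall E)}
    (h : Tendsto (fun M => N M • D) atTop (𝓝 0)) : D = 0 := by
  refine PowerSeries.ext fun k => ?_
  rw [map_zero]
  have hk : Tendsto (fun M => PowerSeries.coeff k (N M • D)) atTop (𝓝 0) := by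
    have h0 := ((PowerSeries.WithPiTopology.continuous_coeff (unitBall E) k).tendsto 0).comp h
    rwa [map_zero] at h0
  have hk' : Tendsto (fun M => ‖(((PowerSeries.coeff k (N M • D) : unitBall E)) : E)‖) atTop (𝓝 0) := by
    have h1 := ((continuous_norm.comp continuous_subtype_val).tendsto (0 : unitBall E)).comp hk
    have e : ((fun a : E => ‖a‖) ∘ Subtype.val) (0 : unitBall E) = 0 := by
      rw [Function.comp_apply, ZeroMemClass.coe_zero, norm_zero]
    rw [e] at h1
    exact h1
  have hconst : (fun M => ‖(((PowerSeries.coeff k (N M • D) : unitBall E)) : E)‖) = fun _ => ‖((PowerSeries.coeff k D : unitBall E) : E)‖ := by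
    funext M
    rw [map_nsmul, nsmul_eq_mul, Subring.coe_mul, norm_mul, SubringClass.coe_natCast]
    have h1 : ‖((N M : unitBall E) : E)‖ = 1 := norm_natCast_eq_one_of_not_dvd hπ E (hN M)
    rw [SubringClass.coe_natCast] at h1
    rw [h1, one_mul]
  rw [hconst] at hk'
  have h0 : ‖((PowerSeries.coeff k D : unitBall E) : E)‖ = 0 := tendsto_nhds_unique tendsto_const_nhds hk'
  refine Subtype.ext ?_
  rw [ZeroMemClass.coe_zero (unitBall E)]
  exact norm_eq_zero.mp h0

include hπ in
/-- ★★ **`δ(β·⟨β⟩⁻¹) = 0`** — the Teichmüller family has trivial logarithmic derivative (no residue-field comparison along the tower: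
`(β⟨β⟩⁻¹)^{N_M} → 1` coordinatewise for `N_M = ∏_{i≤M} n_i` prime to `p`, and `δ` is continuous and additive).
[cite: deShalit1987, Ch. I §2.1, §3.4 Lemma (i)] [cite: SerreLocalFields1979, Ch. II §4 Prop. 8] -/
theorem relLogDerivSeries_mul_principalPart_inv_eq_zero (β : RelNormCoherentUnits hπ E) :
    relLogDerivSeries hπ E hq hE hσ₀ (β.mul (β.principalPart.inv hπ E)) = 0 := by
  classical
  set τ := β.mul (β.principalPart.inv hπ E) with hτ
  choose n hn using fun m => RelNormCoherentUnits.exists_isUnit_and_val_mul_principalPart_inv_pow_eq_one hπ E β m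
  set N : ℕ → ℕ := fun M => ∏ i ∈ range (M + 1), n i with hN
  have hNdvd : ∀ {m M : ℕ}, m ≤ M → n m ∣ N M := fun {m M} hmM => Finset.dvd_prod_of_mem n (mem_range.mpr (Nat.lt_succ_of_le hmM))
  have hNp : ∀ M, ¬ ringChar 𝓀[F] ∣ N M := by
    intro M hdvd
    haveI : ∀ i, FiniteDimensional F (E ⊔ ltField π i : IntermediateField F (AlgebraicClosure F)) := fun i =>
      IntermediateField.finiteDimensional_sup E (ltField π i)
    have hp : (ringChar 𝓀[F]).Prime := CharP.char_is_prime 𝓀[F] (ringChar 𝓀[F])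
    obtain ⟨i, -, hi⟩ := (hp.prime.dvd_finsetProd_iff _).mp hdvd
    exact not_ringChar_dvd_of_isUnit_natCast hπ (E ⊔ ltField π i) (hn i).1 hi
  -- `τ ^ N M → 1`
  have hconv : Tendsto (fun M => τ.npow (N M)) atTop (𝓝 (RelNormCoherentUnits.one : RelNormCoherentUnits hπ E)) := by
    rw [(RelNormCoherentUnits.isEmbedding_val hπ E).tendsto_nhds_iff, tendsto_pi_nhds]
    intro m
    refine (tendsto_const_nhds (x := (RelNormCoherentUnits.one : RelNormCoherentUnits hπ E).val m)).congr'
      (eventually_atTop.mpr ⟨m, fun M hmM => ?_⟩)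
    obtain ⟨c, hc⟩ := hNdvd hmM
    change RelNormCoherentUnits.one.val m = (τ.npow (N M)).val m
    rw [RelNormCoherentUnits.val_one, RelNormCoherentUnits.val_npow, hc, pow_mul, (hn m).2, one_pow]
  -- continuity of `δ`
  have hδ : Tendsto (fun M => relLogDerivSeries hπ E hq hE hσ₀ (τ.npow (N M))) atTop (𝓝 0) := by
    have h := ((continuous_relLogDerivSeries hπ E hq hE hσ₀).tendsto (RelNormCoherentUnits.one : RelNormCoherentUnits hπ E)).comp hconv
    rw [relLogDerivSeries_one hπ E hq hE hσ₀] at h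
    exact h
  have hδ' : Tendsto (fun M => N M • relLogDerivSeries hπ E hq hE hσ₀ τ) atTop (𝓝 0) := by
    refine hδ.congr fun M => ?_
    exact relLogDerivSeries_npow hπ hq hE hσ₀ τ (N M)
  exact eq_zero_of_tendsto_nsmul hπ E hNp hδ'

include hπ in
/-- ★★★ **`δ⟨β⟩ = δβ`**: the logarithmic derivative of the Coleman series does not see the Teichmüller part of a norm-coherent unit.
[cite: deShalit1987, Ch. I §3.4 Lemma (i), §3.5 (11)] [cite: SerreLocalFields1979, Ch. II §4 Prop. 8] -/
theorem relLogDerivSeries_principalPart (β : RelNormCoherentUnits hπ E) :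
    relLogDerivSeries hπ E hq hE hσ₀ β.principalPart = relLogDerivSeries hπ E hq hE hσ₀ β := by
  conv_rhs => rw [← RelNormCoherentUnits.principalPart_mul_mul_principalPart_inv hπ E β]
  rw [relLogDerivSeries_mul, relLogDerivSeries_mul_principalPart_inv_eq_zero hπ E hq hE hσ₀ β, add_zero]

include hπ in
/-- ★★ **`(δ⟨β⟩)~ = (δβ)~`.** [cite: deShalit1987, Ch. I §3.7, §3.13] -/
theorem relTildeSeries_principalPart (u : LTCoeff F) (β : RelNormCoherentUnits hπ E) :
    relTildeSeries hπ E hq hE hσ₀ u β.principalPart = relTildeSeries hπ E hq hE hσ₀ u β := by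
  rw [relTildeSeries, relTildeSeries, relLogDerivSeries_principalPart hπ E hq hE hσ₀ β]

include hπ in
/-- ★★ **`r_{⟨β⟩} = r_β`**: the Coleman coordinate does not see the Teichmüller part. [cite: deShalit1987, Ch. I §3.7] -/
theorem relUnitCoordTwo_principalPart (u : (LTCoeff F)ˣ) (hu : LTCoeff.of F π = residueFieldCard F * u) (β : RelNormCoherentUnits hπ E) :
    relUnitCoordTwo hπ E hq hE hσ₀ u hu β.principalPart = relUnitCoordTwo hπ E hq hE hσ₀ u hu β :=
  (eq_relUnitCoordTwo hπ E hq hE hσ₀ u hu β.principalPart (by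
    rw [relTildeSeries_principalPart hπ E hq hE hσ₀]
    exact relTildeSeries_eq_relUnitCoordTwo hπ E hq hE hσ₀ u hu β)).symm

include hπ in
/-- ★★ **`mom_k(r_{⟨β⟩}) = mom_k(r_β)`**: the Coates–Wiles moments of the principal projection are those of the unit itself — so the
(L)-input `hmom` of `Summit…TowerDataOffsetMoment` (stated for `⟨e(𝔞₁)⟩`) is the same number for `e(𝔞₁)`.
[cite: deShalit1987, Ch. I §3.5 (11); Ch. II §4.9] -/
theorem coordMoment_relUnitCoordTwo_principalPart (u : (LTCoeff F)ˣ) (hu : LTCoeff.of F π = residueFieldCard F * u) (k : ℕ)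
    (β : RelNormCoherentUnits hπ E) :
    coordMoment hπ E u k (relUnitCoordTwo hπ E hq hE hσ₀ u hu β.principalPart) = coordMoment hπ E u k (relUnitCoordTwo hπ E hq hE hσ₀ u hu β) := by
  rw [relUnitCoordTwo_principalPart hπ E hq hE hσ₀ u hu β]

end LogDerivPrincipalPart

end Literature.NumberTheory.GaloisRepresentations
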